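import Summits.BirchSwinnertonDyer.BirchSwinnertonDyer.Theorems.GenusKolyvaginAtTwoHeegnerValuationLedger
import HarnessLib

/-!
# Route `GenusKolyvaginAtTwo`, crux K₁⁺ `K1Pos` (stmt-BirchSwinnertonDyer-31468), LINE 31 «su_halves⁺»: stub G′ `stub_valuationLedger` IS A THEOREM

LEAD seat `bsd-line-gk2-p1` g26 (cell `bsd-f1-sign2`), `--supports stmt-BirchSwinnertonDyer-31468`.  THEOREMS ONLY (no definition, no named fact,
no `sorry`).  **BSD is NOT proved by this file; K1Pos is NOT proved; no item is closed.**  CONDITIONAL on the route's four PRINT items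
(`GrossZagierAllLevels`, `MultPublishedInputsAtTwo`, `EntireLFunctionRat`, `MilneAnyModel`), displayed as binders exactly as in the stub.

* `k1Pos_valuationLedger_eq` — on a K₁⁺ frame (pen's LINE 31 v1.3 binders of G′, for EVERY depth `M₀ ≥ 0`): **`2·M₀ = ord₂ qW + ord₂ qd`** for the
  rational values `#Ш_an(E) = qW`, `#Ш_an(Wd) = qd` — the Heegner valuation ledger `ValuationLedger.two_mul_depth_eq_padicValRat_add` with its
  two algebraic inputs discharged on the cell: `Ш(Wd/ℚ)[2^∞] = 0` (`rank Wd(ℚ) = 1` by GZK, `#Sel₂(Wd) = 2`) and `#Ш(E_K/K)[2^∞] = 1 = #Ш(E/ℚ)[2^∞]`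
  (Lossless §1 `natCard_primaryComponent_sha_baseChange_two_eq_one_of_natCard_selmerGroup_eq_one` + `#Sel₂(E) = 1`).
* `k1Pos_valuationLedger` — **LINE 31 stub G′ `stub_valuationLedger` VERBATIM** (the inequality `2·M₀ ≤ ord₂ qW + ord₂ qd` the composition
  `K1Pos_of` consumes); pen: plug `stub_valuationLedger := …ValuationLedger.k1Pos_valuationLedger`.
READING: with G′ a theorem, LINE 31 = A (`stub_rankZeroHalf`, the rank-0 wall) + B1′ ((★)-frame supply) + B2′ (swapped ledger) + B3 (rank-0
integrality); nothing beyond print is claimed here.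

References: [GrossZagier1986] V §2 (2.2); [Milne1972ArithmeticAV] §1 Thm. 1; [Kramer1981] Thm. 1; [Miller2011LMS] Def. 1.1; [SilvermanAEC2009] Thm. X.4.2.
-/

set_option autoImplicit false
set_option linter.dupNamespace false -- `Summit.<P>.<Sub>` repeats `BirchSwinnertonDyer` (D-0017)

noncomputable section

open scoped Classical

namespace Summit.BirchSwinnertonDyer.BirchSwinnertonDyer.Theorems.GenusExact.ValuationLedger

open WeierstrassCurve NumberField Literature.NumberTheory.EllipticCurves Literature.NumberTheory.EllipticCurves.ModularForms
  Literature.NumberTheory.GaloisRepresentations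
  Summit.BirchSwinnertonDyer.BirchSwinnertonDyer.Theses.GenusKolyvaginAtTwo
  Summit.BirchSwinnertonDyer.BirchSwinnertonDyer.Theorems.GenusSupplyNarrow.Lossless

/-- **THE K₁⁺ VALUATION LEDGER, EXACT FORM**: on a K₁⁺ frame (LINE 31 G′ binders: habitat curve `E = W` with `Δ > 0` and `#Sel₂(E) = 1`, an
`(H2)` field `K`, odd-Manin `Dt`, `d₁` with `2^(M₀) ∥ P(1)` for ANY `M₀ ≥ 0`, the `Sel₂`-minimal rank-one twin `Wd` with `ord₂ C(Wd) = 0`) and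
rational values `#Ш_an(E) = qW`, `#Ш_an(Wd) = qd`: **`2·M₀ = ord₂ qW + ord₂ qd`** (all three algebraic `Ш[2^∞]` vanish on the cell).
CONDITIONAL on the four print items; BSD / K1Pos NOT proved. [cite: GrossZagier1986, V §2 (2.2)] [cite: Milne1972ArithmeticAV, §1 Thm. 1]
[cite: Kramer1981, Thm. 1] [cite: Miller2011LMS, Def. 1.1] -/
theorem k1Pos_valuationLedger_eq (hGZ : GrossZagierAllLevels) (hGZK : MultPublishedInputsAtTwo) (hL : EntireLFunctionRat)
    (hMi : MilneAnyModel)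
    (W : WeierstrassCurve ℚ) [W.IsElliptic] [W.IsGloballyMinimal] [NeZero (W.conductorNorm ℤ)]
    (_hcm : ¬ W.HasCM) (hr0 : W.analyticRank = 0) (hρ : ∀ n : ℕ, 0 < n → W.HasSurjectiveModNGaloisRep ((2 : ℤ) ^ n))
    (hT : Odd W.tamagawaProduct) (hpos : 0 < W.Δ) (hSel1 : Nat.card (W.selmerGroup 2) = 1)
    (K : Type) [Field K] [NumberField K] (hIQ : IsImaginaryQuadratic K) (hodd : Odd (NumberField.discr K))
    (h3 : NumberField.discr K ≠ -3) (hHe : SatisfiesHeegnerHypothesis (W.conductorNorm ℤ) K)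
    (_hsq1 : ¬ IsSquare ((NumberField.discr K : ℚ) * -|W.Δ|)) (_hsq2 : ¬ IsSquare ((NumberField.discr K : ℚ) * (-(2 * |W.Δ|))))
    (Dt : ModularParametrizationData W (W.conductorNorm ℤ))
    (_hopt : ∀ z ∈ Dt.L.lattice, ∃ w ∈ periodLattice Dt.f, z = (Dt.c : ℂ) * w) (hc : Odd Dt.c)
    (β : ℤ) (ι : K →+* ℂ) (d₁ : KolyvaginHeegnerData Dt β ι 1) (hy : ¬ IsOfFinAddOrder d₁.derivedPoint)
    (M₀ : ℕ) (hdiv : ∃ Q : (W.baseChange (ringClassField K ι 1)).toAffine.Point, ((2 ^ M₀ : ℕ) : ℤ) • Q = d₁.derivedPoint)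
    (hndiv : ¬ ∃ Q : (W.baseChange (ringClassField K ι 1)).toAffine.Point, ((2 ^ (M₀ + 1) : ℕ) : ℤ) • Q = d₁.derivedPoint)
    (Wd : WeierstrassCurve ℚ) [Wd.IsElliptic] [Wd.IsGloballyMinimal]
    (hWd : ∃ C : VariableChange ℚ, C • W.quadraticTwist (NumberField.discr K : ℚ) = Wd)
    (hrd : Wd.analyticRank = 1) (hSel : Nat.card (Wd.selmerGroup 2) = 2) (hDEF : padicValNat 2 Wd.tamagawaProduct = 0)
    (qW qd : ℚ) (hqW : shaAn W = (qW : ℂ)) (hqd : shaAn Wd = (qd : ℂ)) :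
    2 * (M₀ : ℤ) = padicValRat 2 qW + padicValRat 2 qd := by
  haveI : Fact (Nat.Prime 2) := ⟨Nat.prime_two⟩
  have hρ2 : W.HasSurjectiveModNGaloisRep 2 := by simpa using hρ 1 one_pos
  -- `Ш(Wd/ℚ)[2^∞] = 0`: `rank Wd(ℚ) = 1` (GZK) and `#Sel₂(Wd) = 2`
  have hrk : Wd.mordellWeilRank = 1 := (hGZK Wd (by rw [hrd])).1.trans hrd
  have hD := natCard_primaryComponent_sha_two_eq_one_of_rank_one Wd hrk hSel
  -- `Ш(E_K/K)[2^∞] = 0` (Lossless §1) and `Ш(E/ℚ)[2^∞] = 0` (`#Sel₂(E) = 1`)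
  have hK1 := natCard_primaryComponent_sha_baseChange_two_eq_one_of_natCard_selmerGroup_eq_one W K hT hr0 hSel1 hIQ hodd hHe hρ2 Dt β ι
    d₁ hy M₀ hndiv Wd hWd hSel (Or.inr ⟨hpos, hDEF⟩)
  have h1' : Nat.card (W.selmerGroup ((2 : ℕ) : ℤ)) = 1 := by rw [Nat.cast_ofNat]; exact hSel1
  have hW1 : Nat.card (AddCommGroup.primaryComponent (↥W.sha) 2) = 1 := by
    rw [primaryComponent_sha_eq_bot_of_natCard_selmerGroup_eq_one W 2 h1']; exact AddSubgroup.card_bot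
  exact two_mul_depth_eq_padicValRat_add hGZ hGZK hL hMi W hρ2 hT hr0 K hIQ hodd h3 hHe Dt hc β ι d₁ hdiv hndiv Wd hWd hrd hqW hqd hD
    (by intro _ _; rw [hK1, hW1])

/-- **LINE 31 «su_halves⁺» STUB G′ `stub_valuationLedger` — VERBATIM** (pen bsd-idea-1 g26, `Cruxes/K1Pos/Lines/su_halves.lean` v1.3 (mirror of LINE 30)): on a K₁⁺ frame,
for the rational values `#Ш_an(E) = qW`, `#Ш_an(Wd) = qd`, **`2·M₀ ≤ ord₂ qW + ord₂ qd`** (in truth `=`, `k1Pos_valuationLedger_eq`).  Pen: plug by name.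
CONDITIONAL on the four print items; BSD / K1Pos NOT proved — the line's open content is A / B1′ / B2′ / B3. [cite: GrossZagier1986, V §2 (2.2)]
[cite: Milne1972ArithmeticAV, §1 Thm. 1] [cite: Miller2011LMS, Def. 1.1] -/
theorem k1Pos_valuationLedger (hGZ : GrossZagierAllLevels) (hGZK : MultPublishedInputsAtTwo) (hL : EntireLFunctionRat)
    (hMi : MilneAnyModel)
    (W : WeierstrassCurve ℚ) [W.IsElliptic] [W.IsGloballyMinimal] [NeZero (W.conductorNorm ℤ)]
    (hcm : ¬ W.HasCM) (hr0 : W.analyticRank = 0) (hρ : ∀ n : ℕ, 0 < n → W.HasSurjectiveModNGaloisRep ((2 : ℤ) ^ n))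
    (hT : Odd W.tamagawaProduct) (hpos : 0 < W.Δ) (hSel1 : Nat.card (W.selmerGroup 2) = 1)
    (K : Type) [Field K] [NumberField K] (hIQ : IsImaginaryQuadratic K) (hodd : Odd (NumberField.discr K))
    (h3 : NumberField.discr K ≠ -3) (hHe : SatisfiesHeegnerHypothesis (W.conductorNorm ℤ) K)
    (hsq1 : ¬ IsSquare ((NumberField.discr K : ℚ) * -|W.Δ|)) (hsq2 : ¬ IsSquare ((NumberField.discr K : ℚ) * (-(2 * |W.Δ|))))
    (Dt : ModularParametrizationData W (W.conductorNorm ℤ))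
    (hopt : ∀ z ∈ Dt.L.lattice, ∃ w ∈ periodLattice Dt.f, z = (Dt.c : ℂ) * w) (hc : Odd Dt.c)
    (β : ℤ) (ι : K →+* ℂ) (d₁ : KolyvaginHeegnerData Dt β ι 1) (hy : ¬ IsOfFinAddOrder d₁.derivedPoint)
    (M₀ : ℕ) (hdiv : ∃ Q : (W.baseChange (ringClassField K ι 1)).toAffine.Point, ((2 ^ M₀ : ℕ) : ℤ) • Q = d₁.derivedPoint)
    (hndiv : ¬ ∃ Q : (W.baseChange (ringClassField K ι 1)).toAffine.Point, ((2 ^ (M₀ + 1) : ℕ) : ℤ) • Q = d₁.derivedPoint)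
    (Wd : WeierstrassCurve ℚ) [Wd.IsElliptic] [Wd.IsGloballyMinimal]
    (hWd : ∃ C : VariableChange ℚ, C • W.quadraticTwist (NumberField.discr K : ℚ) = Wd)
    (hrd : Wd.analyticRank = 1) (hSel : Nat.card (Wd.selmerGroup 2) = 2) (hDEF : padicValNat 2 Wd.tamagawaProduct = 0)
    (qW qd : ℚ) (hqW : shaAn W = (qW : ℂ)) (hqd : shaAn Wd = (qd : ℂ)) :
    (2 * (M₀ : ℤ)) ≤ padicValRat 2 qW + padicValRat 2 qd :=
  (k1Pos_valuationLedger_eq hGZ hGZK hL hMi W hcm hr0 hρ hT hpos hSel1 K hIQ hodd h3 hHe hsq1 hsq2 Dt hopt hc β ι d₁ hy M₀ hdiv hndiv Wd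
    hWd hrd hSel hDEF qW qd hqW hqd).le

end Summit.BirchSwinnertonDyer.BirchSwinnertonDyer.Theorems.GenusExact.ValuationLedger

end
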